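import Summits.QuantumFields.YangMills.Theorems.BalabanUVNodesN16OfSocketsZd3
import Literature.MathematicalPhysics.QuantumFieldTheory.Balaban1983to89.B8IdxB8LawsB
import HarnessLib

/-!
# Route «BalabanUVNodes» (K3⁗ `SpineGivenEndpointR13Sep`), DAG node N16 = NE3 — THE N05 → N16 EDGE KEYED AT THE PINNED ALL-TORUS MEMBERS (`η = L^{−k}`), I.E. INSIDE
# NODE N05's SUB-INDEX OF RECORD `IdxB8SubB` (the four index laws №7 scale ∕ №8 truncation ∕ №11 cover ∕ №12 bonds of `B8IdxB8LawsB`) — the minimal socket demand of N16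

Cell `pub-ymgap`, seat `pub-ymgap-dag-n16-c` (R134 fan-out seat, strategy s1; HUMAN RULING D-0062; chair R424 venue), generation 6, file 47 — over generation 0's files
4b ∕ 5 (`N16.Thm4ZdPrintOfLeaf.thm4TorusAt_zero_print_of_leaf_member`, `N16.OfLeaf.thm4TorusAt_print_of_leaf` ∕ `n16_of_leaf`), generation 5's file 42 and this
generation's files 45 ∕ 46 (`N16OfSocketsAllTorus`, `N16HolderMSOfSocketsAllTorus`), and n05-c's four-law sub-index `B8IdxB8LawsB` (node N05's record pin
`Node00/CarriersB8SubB`).  `--supports stmt-QuantumFields-20292 --as helper` (K3⁗).  `bears_on: R4∕N16 · edge N05 → N16`.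

WHY.  Files 45 ∕ 46 re-keyed the edge at the all-torus PROPER members for EVERY spacing `η > 0`; N16 reads the leaf only at `η = L^{−k}` (file 5's hookup), and node
N05's family of record ranges over `IdxB8SubB` = univ members obeying the scale law №7 `Lᵏη ≤ 1`, the truncation law №8, the cover law №11 and the bond law №12 — laws
that EXCLUDE the two vacuity witnesses known for socket binders at univ members (this seat's empty-truncation member, p511253: violates №8; n05-c ∕ ref-A's
empty-bond members `B8IdxB8LawsB.not_idxB8LawsB_of_bonds_empty`: violate №12).  THIS file pins the spacing: the sub-index
`{i : ZdIdx 4 L // (∀ j, i.Ω j = univ) ∧ (∀ m j, i.Λs m j = {j = m}) ∧ (∀ m j, i.Λb m j = {j = m}) ∧ i.η = (L⁻¹)^{i.k}}` (spelled inline), EVERY member of which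
obeys all four laws (`idxB8LawsB_allTorusPinned`, by n05-c's `idxB8LawsB_of_member_univ`) — so a supplier holding the five sockets on N05's record sub-index
`IdxB8SubB` serves §4 below by restriction, and N16 asks for nothing outside N05's record.

WHAT THIS FILE PROVES (kernel, theorems only, 0 `def`, 0 sorry):
* §1 `idxB8LawsB_allTorusPinned` — every member of the pinned all-torus sub-index satisfies `B8IdxB8LawsB.IdxB8LawsB L i` (the bridge to N05's record sub-index).
* §2 `thm4TorusAt_print_of_leaf_allTorusPinned` — file 5's (T4^ℤᵈ_print) at every `k ≥ 1`, `η = L^{−k}`, from `B8.Thm4Body` ∕ `B8.Prop3Body` read on the PINNED sub-family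
  (`M_n ℂ`; file 4b's `…_member` at the member of `exists_member_univ` at `η = (Lᵏ)⁻¹`, which is pinned).
* §3 `n16_of_leafAllTorusPinned` — file 5's `n16_of_leaf` (β = 1 root of record) with the two leaf clauses read on the pinned sub-family; conclusion VERBATIM.
* §4 ★ `n16_of_socketsAllTorusPinned` — file 42's `n16_of_socketsZd3E` with n05-a's five sockets demanded AT THE PINNED ALL-TORUS MEMBERS ONLY (⊂ `IdxB8SubB`);
  conclusion VERBATIM.

HONEST FRAMING: a re-key by name; nothing of Bałaban is proved here; the five sockets at the pinned members are node N05's ∕ N06's open obligations, (H3ˢᵘᵖ) = N07's;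
N16 ∕ NE3 NOT discharged; count-neutral; one finite four-torus at fixed ε — NOT ℝ⁴, NOT infinite volume, NOT OS, NOT a mass gap, NOT Clay.
-/

set_option autoImplicit false

open scoped BigOperators Matrix Matrix.Norms.L2Operator
open NormedSpace

namespace Summit.QuantumFields.YangMills.BalabanUVNodes.N16OfSocketsAllTorusPinned

open Literature.MathematicalPhysics.QuantumFieldTheory.Balaban1983to89
open B7Prop1Explicit B7Prop2Explicit
open B7Prop3Flat (c3)
open B7Eq78Linearization (conjR)
open B7Eq92Concrete (mgauge)
open B8Ineq132 (InAk covDerivFwd)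
open B8Eq184Proof (cfgExp)
open B8Eq119TwistedAxial (Restr129)
open B8Eq133Hypotheses (Reg335Zd)
open B8Eq138LandauZd (IsLandau138 covLap)
open B9Eq340HolderZd (AdmPair mem_admPair)
open B8Thm4TorusAt (torusLam Thm4TorusAt)
open B8LeafModelZd (ZdIdx SockP5base SockP5 SockH59)
open B8LeafModelZd3 (zdGF3 SockB9P3)
open B8LeafModelZdSockP5uE (SockP5uE)
open B8LeafModelZd3NonVacuity (exists_member_univ)
open B8IdxB8LawsB (IdxB8LawsB idxB8LawsB_of_member_univ)
open Summit.QuantumFields.BalabanUV.T4Continuum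
open T4AveragingDeficitWall (Ad)
open BlockAverageCurrent (curConst)
open NE3EnergyWeightedCovShape (NE3EnergyRateWCov)
open NE3RightInverseSupLetters (frameC)
open NE3.LeafIndexSockets (LeafH3sup)
open MinimalActionRate (sfClass)
open Summit.QuantumFields.YangMills.BalabanUVNodes.N16.Thm4ZdPrintOfLeaf (thm4TorusAt_zero_print_of_leaf_member)
open Summit.QuantumFields.YangMills.BalabanUVNodes.N16.OfLeaf (exists_window_print thm4TorusAt_concl_congr)
open Summit.QuantumFields.YangMills.BalabanUVNodes.N16 (n16_of_thm4Zd_print)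

noncomputable section

variable {d : ℕ}

/-! ## §1 The pinned all-torus members obey node N05's four index laws (bridge to `IdxB8SubB`) -/

/-- **EVERY PINNED ALL-TORUS MEMBER OBEYS THE FOUR INDEX LAWS OF NODE N05's RECORD SUB-INDEX** (№7 scale — with equality `Lᵏη = 1`; №8 truncation; №11 cover;
№12 bonds): n05-c's `B8IdxB8LawsB.idxB8LawsB_of_member_univ` BY NAME.  Hence a socket family held over `IdxB8SubB θ` (`= {i : IdxB8 θ // IdxB8LawsB θ.L i.1}`)
restricts to the pinned all-torus sub-index of §2–§4 (`L = θ.L`, `d = θ.D`). [cite: Balaban1985RegularSpaces, p.77 («Ω_j = T_η», (1.3)–(1.6)), (1.12) p.78, p.86] -/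
theorem idxB8LawsB_allTorusPinned {L : ℕ} (hL : 1 ≤ L)
    (i : {i : ZdIdx d L // (∀ j, i.Ω j = Set.univ) ∧ (∀ m j, i.Λs m j = {_y | j = m}) ∧ (∀ m j, i.Λb m j = {_c | j = m}) ∧ i.η = ((L : ℝ)⁻¹) ^ i.k}) :
    IdxB8LawsB L i.1 :=
  idxB8LawsB_of_member_univ hL i.2.2.2.2 i.2.1 i.2.2.1 i.2.2.2.1

/-! ## §2 Theorem 4 ∧ Proposition 3 on the PINNED all-torus sub-family ⟹ file 2's (T4^ℤᵈ_print) at `η = L^{−k}` -/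

section Matrices

variable {n : Type} [Fintype n] [DecidableEq n]

/-- **THE LEAF CLAUSES ON THE PINNED ALL-TORUS SUB-FAMILY ⟹ FILE 2's (T4^ℤᵈ_print), VERBATIM** (`𝔸 = M_n(ℂ)`; `d, L ≥ 2`; Hölder data `β ≥ 0`, `len ≥ 1` on its support,
`len e_μ = 1`; constants and window as in file 4b): file 5's `thm4TorusAt_print_of_leaf` with `B8.Thm4Body` ∕ `B8.Prop3Body` read on `fun i ↦ zdGF3 (M_n ℂ) L β len i.1`
over `{i // (∀ j, i.Ω j = univ) ∧ (∀ m j, i.Λs m j = {j = m}) ∧ (∀ m j, i.Λb m j = {j = m}) ∧ i.η = (L⁻¹)^{i.k}}` — at every `k ≥ 1` the member of `exists_member_univ` at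
`η = (Lᵏ)⁻¹` is pinned, file 4b's `…_member` applies there, and file 5's letter identities at `Lᵏη = 1` finish.
[cite: Balaban1985RegularSpaces, Thm 4 p.88, Prop. 3 p.87, (1.36)–(1.39) pp.82–83, p.77 («Ω_j = T_η»)] -/
theorem thm4TorusAt_print_of_leaf_allTorusPinned [Nonempty n] (hd2 : 2 ≤ d) {L : ℕ} (hL : 2 ≤ L) {β : ℝ} (hβ : 0 ≤ β) {len : Site d → ℝ}
    (hlen : ∀ v : Site d, 0 < len v → 1 ≤ len v) (hlen1 : ∀ μ : Fin d, len (e μ) = 1) {c₁ c₁' B₁' cP C₂ B₀β : ℝ} {inp : B8.B9Inputs}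
    (hB₁' : 0 < B₁') (hBB : 5 * (d : ℝ) * L * inp.B₀ ≤ B₁')
    (hwin : ∀ α₀ α₁ : ℝ, 0 < α₀ → 0 < α₁ → α₀ + α₁ ≤ c₁' →
      α₀ + α₁ ≤ c₁ ∧ C0 d * (2 * α₀) ≤ 1 / 3 ∧ 4 * α₀ ≤ c2' d L ∧ 16 * (B₁' * (α₀ + α₁)) ≤ 1 ∧
      Real.exp (4 * (800 * ((d : ℝ) + 1) ^ 2 * ((d : ℝ) + 4)) * α₀) * (1 + 8 * (131072 * ((d : ℝ) + 1) ^ 2) * (B₁' * (α₀ + α₁))) ≤ 2 ∧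
      2 * (B₁' * (α₀ + α₁)) ≤ c3 d L ∧ (d : ℝ) * L * α₁ ≤ 1 / 8 ∧ α₀ ≤ cP ∧ α₁ ≤ cP ∧ B₁' * (α₀ + α₁) ≤ cP ∧
      2 * (B₁' * (α₀ + α₁)) ^ 2 + 20 * d * α₀ * (B₁' * (α₀ + α₁)) + 2 * C₂ * (B₁' * (α₀ + α₁)) ^ 2 ≤ α₀ + α₁)
    (Reg : ℕ → (Site d → Fin d → (Matrix n n ℂ)ˣ) → Prop) :
    letI : CStarAlgebra (Matrix n n ℂ) := {}
    B8.Thm4Body c₁ B₁' (fun i : {i : ZdIdx d L // (∀ j, i.Ω j = Set.univ) ∧ (∀ m j, i.Λs m j = {_y | j = m}) ∧ (∀ m j, i.Λb m j = {_c | j = m}) ∧ i.η = ((L : ℝ)⁻¹) ^ i.k} =>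
      (zdGF3 (Matrix n n ℂ) L β len i.1).toGFData) →
    B8.Prop3Body cP d (L : ℝ) C₂ inp B₀β (fun i : {i : ZdIdx d L // (∀ j, i.Ω j = Set.univ) ∧ (∀ m j, i.Λs m j = {_y | j = m}) ∧ (∀ m j, i.Λb m j = {_c | j = m}) ∧ i.η = ((L : ℝ)⁻¹) ^ i.k} =>
      (zdGF3 (Matrix n n ℂ) L β len i.1).toGFData2) →
    ∀ k, 1 ≤ k → Thm4TorusAt L k 0 (((L : ℝ) ^ k)⁻¹) c₁' (unitaryUnits (Matrix n n ℂ)) (Reg k) (Restr129 L k (torusLam k))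
      (fun (α₀ α₁ : ℝ) (U₀ U' : Site d → Fin d → (Matrix n n ℂ)ˣ) (u : Site d → (Matrix n n ℂ)ˣ) =>
        ∃ A : Site d → Fin d → Matrix n n ℂ,
          (∀ x μ, IsSelfAdjoint (A x μ)) ∧ mgauge U₀ u (cfgExp (((L : ℝ) ^ k)⁻¹) A) = U' ∧
          (∀ x μ, ‖A x μ‖ ≤ 5 * (d : ℝ) * L * inp.B₀ * (α₀ + α₁)) ∧
          (∀ (μ : Fin d) (x : Site d) (κ : Fin d),
            ‖covDerivFwd (((L : ℝ) ^ k)⁻¹) U₀ μ (fun z => A z κ) x‖ ≤ 5 * (d : ℝ) * L * inp.B₀ * (α₀ + α₁)) ∧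
          IsLandau138 L k (((L : ℝ) ^ k)⁻¹) Set.univ (torusLam k) U₀ A ∧
          (∀ (μ : Fin d) (y : Site d) (κ : Fin d),
            ‖Ad (U₀ y μ) (covDerivFwd (((L : ℝ) ^ k)⁻¹) U₀ μ (fun z => A z κ) (y + e μ))
                - covDerivFwd (((L : ℝ) ^ k)⁻¹) U₀ μ (fun z => A z κ) y‖
              ≤ 5 * (d : ℝ) * L * B₀β * (α₀ + α₁) * (((L : ℝ)⁻¹) ^ k) ^ β) ∧
          (∀ (x : Site d) (κ : Fin d), ‖covLap (((L : ℝ) ^ k)⁻¹) U₀ (fun z => A z κ) x‖ ≤ 5 * (d : ℝ) * L * inp.B₀ * (α₀ + α₁))) := by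
  letI : CStarAlgebra (Matrix n n ℂ) := {}
  intro hT hP k hk
  have hL1 : 1 ≤ L := le_trans (by norm_num) hL
  have hL1r : (1 : ℝ) ≤ L := by exact_mod_cast hL1
  have hLk : (1 : ℝ) ≤ (L : ℝ) ^ k := one_le_pow₀ hL1r
  have hη : 0 < ((L : ℝ) ^ k)⁻¹ := by positivity
  have hη1 : ((L : ℝ) ^ k)⁻¹ ≤ 1 := inv_le_one_of_one_le₀ hLk
  obtain ⟨i, -, hik, hiη, hΩ, hΛs, hΛb⟩ := exists_member_univ (d := d) hL1 hk hη
  have hpin : i.η = ((L : ℝ)⁻¹) ^ i.k := by rw [hiη, hik, inv_pow]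
  have h := thm4TorusAt_zero_print_of_leaf_member hd2 hL hβ hlen i hΩ hΛs hB₁' hBB hwin (Reg k) (hT ⟨i, hΩ, hΛs, hΛb, hpin⟩)
    (hP ⟨i, hΩ, hΛs, hΛb, hpin⟩)
  rw [hik, hiη] at h
  refine thm4TorusAt_concl_congr (fun α₀ α₁ U₀ U' u => ?_) h
  -- the letter identities at `η = L^{-k}`
  have hw : (L : ℝ) ^ k * ((L : ℝ) ^ k)⁻¹ = 1 := mul_inv_cancel₀ (by positivity)
  have hw2 : ((L : ℝ) ^ k * ((L : ℝ) ^ k)⁻¹) ^ (-(2 : ℝ)) = 1 := by rw [hw, Real.one_rpow]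
  have hw3 : ((L : ℝ) ^ k * ((L : ℝ) ^ k)⁻¹) ^ (-(3 : ℝ)) = 1 := by rw [hw, Real.one_rpow]
  have hwβ : ((L : ℝ) ^ k * ((L : ℝ) ^ k)⁻¹) ^ (-(2 + β)) = 1 := by rw [hw, Real.one_rpow]
  have hηβ : ∀ μ : Fin d, (((L : ℝ) ^ k)⁻¹ * len (e μ)) ^ β = (((L : ℝ)⁻¹) ^ k) ^ β := fun μ => by
    rw [hlen1 μ, mul_one, inv_pow]
  have hadm : ∀ (μ : Fin d) (y : Site d), (y, y + e μ) ∈ AdmPair (((L : ℝ) ^ k)⁻¹) len := fun μ y => by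
    rw [mem_admPair]
    simp only [add_sub_cancel_left, hlen1 μ, mul_one]
    exact ⟨one_pos, hη1⟩
  constructor
  · rintro ⟨A, h1, h2, h3, h4, h5, h6, h7⟩
    refine ⟨A, h1, h2, fun x μ => ?_, fun μ x κ => ?_, h5, fun μ y κ => ?_, fun x κ => ?_⟩
    · have h := h3 x μ; rwa [hw, inv_one, mul_one] at h
    · have h := h4 μ x κ; rwa [hw2, mul_one] at h
    · have h := h6 μ y κ (hadm μ y); rwa [hwβ, mul_one, hηβ μ] at h
    · have h := h7 x κ; rwa [hw3, mul_one] at h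
  · rintro ⟨A, h1, h2, h3, h4, h5, h6, h7⟩
    refine ⟨A, h1, h2, fun x μ => ?_, fun μ x κ => ?_, h5, fun μ y κ _ => ?_, fun x κ => ?_⟩
    · rw [hw, inv_one, mul_one]; exact h3 x μ
    · rw [hw2, mul_one]; exact h4 μ x κ
    · rw [hwβ, mul_one, hηβ μ]; exact h6 μ y κ
    · rw [hw3, mul_one]; exact h7 x κ

/-! ## §3 N16 ∕ NE3 (β = 1, the root of record) from the leaf clauses on the pinned all-torus sub-family and N07's (H3ˢᵘᵖ) -/

/-- **N16 · NE3 FROM THE [B8] LEAF ON THE PINNED ALL-TORUS SUB-FAMILY OF `zdGF3 (M_n(ℂ))` AND N07's (H3ˢᵘᵖ)** (`d = 4`, `L ≥ 2`, `N ≥ 1`, `β₀ = 1`, `len ≥ 1` on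
its support with `len e_μ = 1`): generation 0's `N16.OfLeaf.n16_of_leaf` with the two leaf clauses read over the PINNED all-torus sub-index (`η = L^{−k}`, inside N05's
`IdxB8SubB`); every other letter and the conclusion VERBATIM, ending in `LeafH3sup 4 L N ε b′ c′ dom → NE3EnergyRateWCov 4 (sfClass 4 L N ε) L N b g C s₁ s₂ dom`.
N16 ∕ NE3 NOT proved. [cite: Balaban1985RegularSpaces, Thm 4 p.88, Prop. 3 p.87] [folklore] -/
theorem n16_of_leafAllTorusPinned [Nonempty n] {L N : ℕ} (hL : 2 ≤ L) (hN : 1 ≤ N) :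
    letI : CStarAlgebra (Matrix n n ℂ) := {}
    ∃ r : ℝ, 0 < r ∧ ∀ ⦃g : ℝ⦄, 0 < g → ∃ C : ℝ, 0 ≤ C ∧
      ∀ (c₁ c₁' B₁' cP C₂ B₀β : ℝ) (inp : B8.B9Inputs) (len : Site 4 → ℝ), (∀ v : Site 4, 0 < len v → 1 ≤ len v) →
      (∀ μ : Fin 4, len (e μ) = 1) → 0 < B₁' → 5 * ((4 : ℕ) : ℝ) * L * inp.B₀ ≤ B₁' → 16 * (5 * ((4 : ℕ) : ℝ) * L * inp.B₀ * c₁') ≤ 1 →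
      (∀ α₀ α₁ : ℝ, 0 < α₀ → 0 < α₁ → α₀ + α₁ ≤ c₁' →
        α₀ + α₁ ≤ c₁ ∧ C0 4 * (2 * α₀) ≤ 1 / 3 ∧ 4 * α₀ ≤ c2' 4 L ∧ 16 * (B₁' * (α₀ + α₁)) ≤ 1 ∧
        Real.exp (4 * (800 * (((4 : ℕ) : ℝ) + 1) ^ 2 * (((4 : ℕ) : ℝ) + 4)) * α₀) *
            (1 + 8 * (131072 * (((4 : ℕ) : ℝ) + 1) ^ 2) * (B₁' * (α₀ + α₁))) ≤ 2 ∧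
        2 * (B₁' * (α₀ + α₁)) ≤ c3 4 L ∧ ((4 : ℕ) : ℝ) * L * α₁ ≤ 1 / 8 ∧ α₀ ≤ cP ∧ α₁ ≤ cP ∧ B₁' * (α₀ + α₁) ≤ cP ∧
        2 * (B₁' * (α₀ + α₁)) ^ 2 + 20 * ((4 : ℕ) : ℝ) * α₀ * (B₁' * (α₀ + α₁)) + 2 * C₂ * (B₁' * (α₀ + α₁)) ^ 2 ≤ α₀ + α₁) →
      ∀ ⦃b' c' : ℝ⦄, 0 ≤ b' → 0 ≤ c' →
      2 ^ 15 * ((4 : ℝ) + 1) ^ 2 * ((4 : ℝ) + 4) ^ 2 * (L : ℝ) ^ 2 * b' ≤ 1 →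
      23040 * (4 : ℝ) ^ 4 * (frameC 4 L + 4) ^ 3 * (c' + curConst 4 L * b' ^ 2) ≤ 1 →
      ∀ ⦃α : ℝ⦄, 0 < α → C0 4 * α ≤ 1 / 3 → 2 * α ≤ c2' 4 L → 11 * (4 : ℝ) ^ 2 * α ≤ 1 / 6 → α + 11 * (4 : ℝ) ^ 2 * α ≤ c₁' →
      b' + 226 * (8 * ((4 : ℝ) + 1) * ((4 : ℝ) + 4)) ^ 2 * b' ^ 2 < α → 4 * ((4 : ℝ) - 1) * (c' + curConst 4 L * b' ^ 2) < α →
      ∀ ⦃Mc : ℝ⦄, 0 ≤ Mc → (Mc + 1) * (b' + 226 * (8 * ((4 : ℝ) + 1) * ((4 : ℝ) + 4)) ^ 2 * b' ^ 2) ≤ 1 / 2 →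
      ∀ (𝒬 : ℕ → Set (Set (Site 4) × ℕ)), (∀ k, ∀ q ∈ 𝒬 k, q.2 ≤ k ∧ ∃ y : Site 4, ∀ z ∈ q.1, (l1 (z - y) : ℝ) ≤ Mc * (L : ℝ) ^ q.2) →
      ∀ ⦃C335 : ℝ⦄, 2 * (Mc + 1) * (b' + 226 * (8 * ((4 : ℝ) + 1) * ((4 : ℝ) + 4)) ^ 2 * b' ^ 2) + 2 * Mc * (2 * (c' + curConst 4 L * b' ^ 2)) +
        4 * Mc * (1 + 2 * Mc) * (b' + 226 * (8 * ((4 : ℝ) + 1) * ((4 : ℝ) + 4)) ^ 2 * b' ^ 2) ^ 2 < C335 →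
      ∀ ⦃ε s₁ b s₂ : ℝ⦄, 0 < ε → ε ≤ r → ε < α → 0 ≤ s₁ → s₁ ≤ r → 0 ≤ b → b ≤ ε / 2 →
      5 * ((4 : ℕ) : ℝ) * L * inp.B₀ * (α + 11 * (4 : ℝ) ^ 2 * α) ≤ s₁ →
      5 * ((4 : ℕ) : ℝ) * L * inp.B₀ * (α + 11 * (4 : ℝ) ^ 2 * α) +
          2 * (b' + 226 * (8 * ((4 : ℝ) + 1) * ((4 : ℝ) + 4)) ^ 2 * b' ^ 2) * s₁ ≤ s₁ →
      5 * ((4 : ℕ) : ℝ) * L * inp.B₀ * (α + 11 * (4 : ℝ) ^ 2 * α) + 16 * (b' + 226 * (8 * ((4 : ℝ) + 1) * ((4 : ℝ) + 4)) ^ 2 * b' ^ 2) *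
          (5 * ((4 : ℕ) : ℝ) * L * inp.B₀ * (α + 11 * (4 : ℝ) ^ 2 * α)) ≤ s₁ →
      5 * ((4 : ℕ) : ℝ) * L * B₀β * (α + 11 * (4 : ℝ) ^ 2 * α) + 8 * (b' + 226 * (8 * ((4 : ℝ) + 1) * ((4 : ℝ) + 4)) ^ 2 * b' ^ 2) *
          (5 * ((4 : ℕ) : ℝ) * L * inp.B₀ * (α + 11 * (4 : ℝ) ^ 2 * α)) ≤ s₂ →
      B8.Thm4Body c₁ B₁' (fun i : {i : ZdIdx 4 L // (∀ j, i.Ω j = Set.univ) ∧ (∀ m j, i.Λs m j = {_y | j = m}) ∧ (∀ m j, i.Λb m j = {_c | j = m}) ∧ i.η = ((L : ℝ)⁻¹) ^ i.k} =>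
        (zdGF3 (Matrix n n ℂ) L 1 len i.1).toGFData) →
      B8.Prop3Body cP 4 (L : ℝ) C₂ inp B₀β (fun i : {i : ZdIdx 4 L // (∀ j, i.Ω j = Set.univ) ∧ (∀ m j, i.Λs m j = {_y | j = m}) ∧ (∀ m j, i.Λb m j = {_c | j = m}) ∧ i.η = ((L : ℝ)⁻¹) ^ i.k} =>
        (zdGF3 (Matrix n n ℂ) L 1 len i.1).toGFData2) →
      ∀ {dom : _root_.Set (Site 4 → Fin 4 → (Matrix n n ℂ)ˣ)},
        LeafH3sup 4 L N ε b' c' dom →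
        NE3EnergyRateWCov 4 (sfClass 4 L N ε) L N b g C s₁ s₂ dom := by
  letI : CStarAlgebra (Matrix n n ℂ) := {}
  obtain ⟨r, hr0, hr⟩ := n16_of_thm4Zd_print (n := n) hL hN
  refine ⟨r, hr0, fun g hg => ?_⟩
  obtain ⟨C, hC0, hC⟩ := hr hg
  refine ⟨C, hC0, fun c₁ c₁' B₁' cP C₂ B₀β inp len hlen hlen1 hB₁' hBB h16 hwin b' c' hb' hc' hRb hcF α hα hA3 hA2 hAs hAc hb'α hc'α Mc hMc
    hMcα 𝒬 h𝒬 C335 hC335 ε s₁ b s₂ hε hεr hεα hs₁ hs₁r hb hbh hss hgrad hℓ hhol hT hP dom h3 => ?_⟩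
  have hB0 : 0 ≤ 5 * ((4 : ℕ) : ℝ) * L * inp.B₀ := by have := inp.B₀_pos.le; positivity
  have hT4 := thm4TorusAt_print_of_leaf_allTorusPinned (d := 4) (by norm_num) hL zero_le_one hlen hlen1 hB₁' hBB hwin
    (fun k => Reg335Zd (((L : ℝ) ^ k)⁻¹) L (𝒬 k) C335) hT hP
  exact hC c₁' (5 * ((4 : ℕ) : ℝ) * L * inp.B₀) (5 * ((4 : ℕ) : ℝ) * L * B₀β) hB0 h16 hb' hc' hRb hcF hα hA3 hA2 hAs hAc hb'α hc'α hMc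
    hMcα 𝒬 h𝒬 hC335 hε hεr hεα hs₁ hs₁r hb hbh hss hgrad hℓ hhol hT4 h3

/-! ## §4 ★ N16 ∕ NE3 from n05-a's five sockets AT THE PINNED ALL-TORUS MEMBERS ONLY (⊂ `IdxB8SubB`), and N07's (H3ˢᵘᵖ) -/

/-- ★ **N16 · NE3 (β = 1, THE DECL OF RECORD's ROOT) FROM NODE N05's FIVE SOCKETS ON THE PINNED ALL-TORUS SUB-FAMILY OF `zdGF3 (M_n(ℂ)) L 1 len` AND N07's
(H3ˢᵘᵖ)** (`d = 4`, `L ≥ 2`, `N ≥ 1`): file 45's `n16_of_socketsAllTorus` with the spacing pinned to `η = L^{−k}` — the sockets `SockP5base ∕ SockP5 ∕ SockH59 ∕ SockP5uE ∕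
SockB9P3` are demanded at the members `(η = (Lᵏ)⁻¹, k, Ω ≡ ℤ⁴, Λs m j = {j = m}, Λb m j = {j = m})` ONLY — every one a member of node N05's record sub-index `IdxB8SubB`
(§1) — so «the five sockets on `IdxB8SubB`» serves this theorem by restriction.  Socket letters, side letters, window and THE END's tail VERBATIM.  N16 ∕ NE3 NOT proved:
the sockets there are node N05's ∕ N06's open obligations, (H3ˢᵘᵖ) is N07's. [cite: Balaban1985RegularSpaces, Thm 4 p.88, Prop. 3 p.87, Prop. 5 p.94, (1.59) p.86, p.77] [folklore] -/
theorem n16_of_socketsAllTorusPinned [Nonempty n] {L N : ℕ} (hL : 2 ≤ L) (hN : 1 ≤ N) :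
    letI : CStarAlgebra (Matrix n n ℂ) := {}
    ∃ r : ℝ, 0 < r ∧ ∀ ⦃g : ℝ⦄, 0 < g → ∃ C : ℝ, 0 ≤ C ∧
      ∀ (C₂ B₀ B₀' cu cP : ℝ) (inp : B8.B9Inputs) (B₀β : ℝ) (len : Site 4 → ℝ),
      (∀ v : Site 4, 0 < len v → 1 ≤ len v) → (∀ μ : Fin 4, len (e μ) = 1) →
      0 < B₀ → inp.B₀ ≤ B₀ → 0 < B₀' → 2 ≤ 5 * ((4 : ℕ) : ℝ) * L * B₀ → 0 < cu → 0 < cP → 0 ≤ B₀β →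
      2097152 * (((4 : ℕ) : ℝ) + 1) ^ 2 ≤ C₂ →
      (∀ i : {i : ZdIdx 4 L // (∀ j, i.Ω j = Set.univ) ∧ (∀ m j, i.Λs m j = {_y | j = m}) ∧ (∀ m j, i.Λb m j = {_c | j = m}) ∧ i.η = ((L : ℝ)⁻¹) ^ i.k}, SockP5base (𝔸 := Matrix n n ℂ) L B₀ B₀' cP i.1.η i.1.k i.1.Ω i.1.Λs) →
      (∀ i : {i : ZdIdx 4 L // (∀ j, i.Ω j = Set.univ) ∧ (∀ m j, i.Λs m j = {_y | j = m}) ∧ (∀ m j, i.Λb m j = {_c | j = m}) ∧ i.η = ((L : ℝ)⁻¹) ^ i.k}, SockP5 (𝔸 := Matrix n n ℂ) L B₀ B₀' cP i.1.η i.1.k i.1.Ω i.1.Λs) →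
      (∀ i : {i : ZdIdx 4 L // (∀ j, i.Ω j = Set.univ) ∧ (∀ m j, i.Λs m j = {_y | j = m}) ∧ (∀ m j, i.Λb m j = {_c | j = m}) ∧ i.η = ((L : ℝ)⁻¹) ^ i.k}, SockH59 (𝔸 := Matrix n n ℂ) L B₀ B₀' cP i.1.η i.1.k i.1.Ω i.1.Λs i.1.Λb) →
      (∀ i : {i : ZdIdx 4 L // (∀ j, i.Ω j = Set.univ) ∧ (∀ m j, i.Λs m j = {_y | j = m}) ∧ (∀ m j, i.Λb m j = {_c | j = m}) ∧ i.η = ((L : ℝ)⁻¹) ^ i.k}, SockP5uE (𝔸 := Matrix n n ℂ) L B₀ cP cu i.1.η i.1.k i.1.Ω i.1.Λs) →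
      (∀ i : {i : ZdIdx 4 L // (∀ j, i.Ω j = Set.univ) ∧ (∀ m j, i.Λs m j = {_y | j = m}) ∧ (∀ m j, i.Λb m j = {_c | j = m}) ∧ i.η = ((L : ℝ)⁻¹) ^ i.k}, SockB9P3 (𝔸 := Matrix n n ℂ) L inp.B₀ B₀β cP 1 len i.1.η i.1.k i.1.Ω i.1.Λs i.1.Λb) →
      ∃ c₁' : ℝ, 0 < c₁' ∧ 16 * (5 * ((4 : ℕ) : ℝ) * L * inp.B₀ * c₁') ≤ 1 ∧
      ∀ ⦃b' c' : ℝ⦄, 0 ≤ b' → 0 ≤ c' →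
      2 ^ 15 * ((4 : ℝ) + 1) ^ 2 * ((4 : ℝ) + 4) ^ 2 * (L : ℝ) ^ 2 * b' ≤ 1 →
      23040 * (4 : ℝ) ^ 4 * (frameC 4 L + 4) ^ 3 * (c' + curConst 4 L * b' ^ 2) ≤ 1 →
      ∀ ⦃α : ℝ⦄, 0 < α → C0 4 * α ≤ 1 / 3 → 2 * α ≤ c2' 4 L → 11 * (4 : ℝ) ^ 2 * α ≤ 1 / 6 → α + 11 * (4 : ℝ) ^ 2 * α ≤ c₁' →
      b' + 226 * (8 * ((4 : ℝ) + 1) * ((4 : ℝ) + 4)) ^ 2 * b' ^ 2 < α → 4 * ((4 : ℝ) - 1) * (c' + curConst 4 L * b' ^ 2) < α →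
      ∀ ⦃Mc : ℝ⦄, 0 ≤ Mc → (Mc + 1) * (b' + 226 * (8 * ((4 : ℝ) + 1) * ((4 : ℝ) + 4)) ^ 2 * b' ^ 2) ≤ 1 / 2 →
      ∀ (𝒬 : ℕ → Set (Set (Site 4) × ℕ)), (∀ k, ∀ q ∈ 𝒬 k, q.2 ≤ k ∧ ∃ y : Site 4, ∀ z ∈ q.1, (l1 (z - y) : ℝ) ≤ Mc * (L : ℝ) ^ q.2) →
      ∀ ⦃C335 : ℝ⦄, 2 * (Mc + 1) * (b' + 226 * (8 * ((4 : ℝ) + 1) * ((4 : ℝ) + 4)) ^ 2 * b' ^ 2) + 2 * Mc * (2 * (c' + curConst 4 L * b' ^ 2)) +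
        4 * Mc * (1 + 2 * Mc) * (b' + 226 * (8 * ((4 : ℝ) + 1) * ((4 : ℝ) + 4)) ^ 2 * b' ^ 2) ^ 2 < C335 →
      ∀ ⦃ε s₁ b s₂ : ℝ⦄, 0 < ε → ε ≤ r → ε < α → 0 ≤ s₁ → s₁ ≤ r → 0 ≤ b → b ≤ ε / 2 →
      5 * ((4 : ℕ) : ℝ) * L * inp.B₀ * (α + 11 * (4 : ℝ) ^ 2 * α) ≤ s₁ →
      5 * ((4 : ℕ) : ℝ) * L * inp.B₀ * (α + 11 * (4 : ℝ) ^ 2 * α) +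
          2 * (b' + 226 * (8 * ((4 : ℝ) + 1) * ((4 : ℝ) + 4)) ^ 2 * b' ^ 2) * s₁ ≤ s₁ →
      5 * ((4 : ℕ) : ℝ) * L * inp.B₀ * (α + 11 * (4 : ℝ) ^ 2 * α) + 16 * (b' + 226 * (8 * ((4 : ℝ) + 1) * ((4 : ℝ) + 4)) ^ 2 * b' ^ 2) *
          (5 * ((4 : ℕ) : ℝ) * L * inp.B₀ * (α + 11 * (4 : ℝ) ^ 2 * α)) ≤ s₁ →
      5 * ((4 : ℕ) : ℝ) * L * B₀β * (α + 11 * (4 : ℝ) ^ 2 * α) + 8 * (b' + 226 * (8 * ((4 : ℝ) + 1) * ((4 : ℝ) + 4)) ^ 2 * b' ^ 2) *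
          (5 * ((4 : ℕ) : ℝ) * L * inp.B₀ * (α + 11 * (4 : ℝ) ^ 2 * α)) ≤ s₂ →
      ∀ {dom : _root_.Set (Site 4 → Fin 4 → (Matrix n n ℂ)ˣ)},
        LeafH3sup 4 L N ε b' c' dom →
        NE3EnergyRateWCov 4 (sfClass 4 L N ε) L N b g C s₁ s₂ dom := by
  letI : CStarAlgebra (Matrix n n ℂ) := {}
  obtain ⟨r, hr0, hr⟩ := n16_of_leafAllTorusPinned (n := n) hL hN
  refine ⟨r, hr0, fun g hg => ?_⟩
  obtain ⟨C, hC0, hC⟩ := hr hg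
  refine ⟨C, hC0, fun C₂ B₀ B₀' cu cP inp B₀β len hlen hlen1 hB₀ hiB hB₀' hB hcu hcP hB₀β hC₂ SP5base SP5 SH59 SP5u SB9 => ?_⟩
  -- node N05's Theorem 4 ∕ Proposition 3 on the PINNED all-torus sub-family from the sockets there (n05-a, `ι := Subtype.val`)
  obtain ⟨c₁t, hc₁t, hT⟩ := B8LeafKnitZd3E.thm4Printed_zd3_mapE (𝔸 := Matrix n n ℂ) (d := 4) (by norm_num) hL (β := (1 : ℝ))
    (len := len) hB₀ hB₀' hB hcu hcP (fun i : {i : ZdIdx 4 L // (∀ j, i.Ω j = Set.univ) ∧ (∀ m j, i.Λs m j = {_y | j = m}) ∧ (∀ m j, i.Λb m j = {_c | j = m}) ∧ i.η = ((L : ℝ)⁻¹) ^ i.k} => i.1) SP5base SP5 SH59 SP5u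
  obtain ⟨cP', hcP', hP⟩ := B8LeafModelZd3Map.prop3Printed_zd3_map (𝔸 := Matrix n n ℂ) (d := 4) (by norm_num) hL inp hB₀β hC₂ hcP
    (1 : ℝ) len (fun i : {i : ZdIdx 4 L // (∀ j, i.Ω j = Set.univ) ∧ (∀ m j, i.Λs m j = {_y | j = m}) ∧ (∀ m j, i.Λb m j = {_c | j = m}) ∧ i.η = ((L : ℝ)⁻¹) ^ i.k} => i.1) SB9
  -- the letter `B₁′ := 5·4·L·B₀` and the window threshold below the two printed thresholds
  have hLpos : (0 : ℝ) < L := by exact_mod_cast (show 0 < L by omega)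
  have hB₁' : 0 < 5 * ((4 : ℕ) : ℝ) * L * B₀ := by positivity
  have hBB : 5 * ((4 : ℕ) : ℝ) * L * inp.B₀ ≤ 5 * ((4 : ℕ) : ℝ) * L * B₀ := mul_le_mul_of_nonneg_left hiB (by positivity)
  obtain ⟨c₁', hc₁', hwin⟩ := exists_window_print (d := 4) (L := L) (by norm_num) hL C₂ hc₁t hcP' hB₁'
  have h16 : 16 * (5 * ((4 : ℕ) : ℝ) * L * inp.B₀ * c₁') ≤ 1 := by
    obtain ⟨-, -, -, h, -⟩ := hwin (c₁' / 2) (c₁' / 2) (by linarith) (by linarith) (by linarith)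
    have h' : 16 * (5 * ((4 : ℕ) : ℝ) * L * B₀ * c₁') ≤ 1 := by rwa [add_halves] at h
    nlinarith [mul_le_mul_of_nonneg_right hBB hc₁'.le]
  refine ⟨c₁', hc₁', h16, fun b' c' hb' hc' hRb hcF α hα hA3 hA2 hAs hAc hb'α hc'α Mc hMc hMcα 𝒬 h𝒬 C335 hC335 ε s₁ b s₂ hε hεr hεα hs₁
    hs₁r hb hbh hss hgrad hℓ hhol dom h3 => ?_⟩
  exact hC c₁t c₁' (5 * ((4 : ℕ) : ℝ) * L * B₀) cP' C₂ B₀β inp len hlen hlen1 hB₁' hBB h16 hwin hb' hc' hRb hcF hα hA3 hA2 hAs hAc hb'α hc'α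
    hMc hMcα 𝒬 h𝒬 hC335 hε hεr hεα hs₁ hs₁r hb hbh hss hgrad hℓ hhol hT hP h3

end Matrices

end

end Summit.QuantumFields.YangMills.BalabanUVNodes.N16OfSocketsAllTorusPinned
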